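import Summits.AtomisticToContinuum.Crystallization.Theses.ThreeConeCertificate
import Summits.AtomisticToContinuum.Crystallization.Theorems.ThreeConeCertificateDefs
import Summits.AtomisticToContinuum.Crystallization.Theorems.ThreeConeCertificateOnePercentCertificateReduction
import Summits.AtomisticToContinuum.Crystallization.Theorems.OnePercentCertificate.Negative.StubLocal

/-!
# `OnePercentCertificate` (stmt-AtomisticToContinuum-11958) — line `KernelTransfer` (strategist s2, ALT line)

Architecture of the crux idea `Ideas/bond-consistency-transfers.md` (round-2 ideator 4; untriaged, unplanned
so far), typed as a checked skeleton that concludes the crux BY NAME.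

THE OBJECT.  Keep the landed split `gS/US/fS/cS` (`Theorems/ThreeConeCertificateDefs.lean`); the crux is then
the local constant `∀ N x, Injective x → −cS·N ≤ E_gS(x)` (`OnePercentReduction.onePercentCertificate_of_local`,
p112372).  Write `2(E_gS + cS N) = Σ_i (s_i + 2cS)` with the site energy `s_i`.  The transfer-free site bound
`s_i/2 + cS ≥ 0` is FALSE (one-centre traps to −0.39; `Disproof.not_hardCoreSiteBound_of_le'`).  Add to each
site a LOCAL ANTISYMMETRIC TRANSFER read from a three-body kernel `t : ℝ → ℝ → ℝ → ℝ`: along the channel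
`(i, j)` the end `i` reads `K_i(i,j) = Σ_{w ∈ ring} t(r_ij, r_iw, r_jw)` over the common neighbours `w` within
ring radius `R` of both ends, and receives `K_i(i,j) − K_j(j,i)`.  Transfers are zero-sum on every finite
configuration (no hard core, no minimal-distance lemma, no partition of space), so

  `(∀ i, 0 ≤ s_i/2 + cS + Σ_{j≠i} transfer) ⟹ −cS·N ≤ E_gS(x)`      (`stable_of_pricedSites`, PROVED here).

At a site all of whose channels are SYMMETRIC (the multiset of ring views `(r_iw, r_jw)` is swap-invariant —
every Bravais-lattice site, by inversion through the bond midpoint; checked numerically for fcc and bcc interior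
sites at ring radius 2: 0 asymmetric channels of 86 / 136; hcp interior sites are NOT symmetric: 18 of their 92
channels, the in-plane `√3·a` and the `√(17/3)·a` ones, have unpaired views — strategist numerics/symcheck.py) the
transfer vanishes identically for EVERY kernel (`transfer_eq_zero_of_symmetric_channel`, PROVED here), so such
sites need the plain floor `s_i/2 + cS ≥ 0` — the lattice-type floor `V_sym ≥ 0` of the card (fcc +0.006782,
bcc +0.038; hcp, asymmetric, is priced by the kernel from its base +0.006728) — while every other site is the
kernel's business: the bond-consistency LP of the card is exactly the statement that SOME kernel makes all
asymmetric sites nonnegative (kit j023401: LP value +0.00673 = hcp's full margin with support = hcp alone through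
20 rounds of column generation; one-centre trap −0.387, compressed C15, over-bound R = 1.15/1.7 patches, capped
icosahedra all priced ≥ +0.00673 by per-(u,w) votes ≤ 0.0006; column generation NOT terminated — no fixed
kernel certified yet: that is the line's first task).

Stubs (2): `stub_symmetricSiteFloor` (the transfer-blind sites: plain one-centre floor; Lean-sized for lattices,
6-dimensional certified computation; refutable by one dense fully-symmetric environment below −2cS in site
energy), `stub_kernelDomination` (∃ kernel pricing every asymmetric site ≥ 0 at ring radius 2 — the LP's
content; Flyspeck-lite to certify once the kernel is frozen as a rational tensor-hat table).
Composition `OnePercentCertificate_of : stub₁ → stub₂ → crux` is a real proof (case split per site, vanishing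
of transfers at symmetric sites, zero-sum, p112372).  Ring radius `2` is the card's v3/v4 value (radius 1.24
and 1.65 leave a symmetric hole of −0.010 / −0.007; radius 2.0 closes it).
-/

noncomputable section

open scoped BigOperators
open Classical
open Literature.MathematicalPhysics.StatisticalMechanics
open Summit.AtomisticToContinuum.Crystallization.Theorems
open Summit.AtomisticToContinuum.Crystallization.Theorems.ThreeConeSplit

namespace Summit.AtomisticToContinuum.Crystallization.Cruxes.OnePercentCertificate.KernelTransfer

local notation "E3" => EuclideanSpace ℝ (Fin 3)

variable {N : ℕ}

/-! ## Objects: rings, kernel prices, transfers, symmetric sites -/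

/-- The RING of the channel `(i, j)` at ring radius `R`: for a channel shorter than the range `5/2` of `gS`, the
common neighbours `w ∉ {i, j}` with `|x_i − x_w| < R` and `|x_j − x_w| < R`; channels of length `≥ 5/2` are not
priced (empty ring). [folklore] -/
def ring (R : ℝ) (x : Fin N → E3) (i j : Fin N) : Finset (Fin N) :=
  if dist (x i) (x j) < 5 / 2 then
    ((Finset.univ.erase i).erase j).filter (fun w => dist (x i) (x w) < R ∧ dist (x j) (x w) < R)
  else ∅

/-- The kernel price read at `i`'s end of the channel `(i, j)`: `Σ_{w ∈ ring} t(r_ij, r_iw, r_jw)`. [folklore] -/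
def kernelPrice (t : ℝ → ℝ → ℝ → ℝ) (R : ℝ) (x : Fin N → E3) (i j : Fin N) : ℝ :=
  ∑ w ∈ ring R x i j, t (dist (x i) (x j)) (dist (x i) (x w)) (dist (x j) (x w))

/-- The transfer INTO `i` along the channel `(i, j)`: what `i` reads minus what `j` reads. [folklore] -/
def transfer (t : ℝ → ℝ → ℝ → ℝ) (R : ℝ) (x : Fin N → E3) (i j : Fin N) : ℝ :=
  kernelPrice t R x i j - kernelPrice t R x j i

/-- The priced site value `s_i/2 + cS + Σ_{j ≠ i} transfer(i, j)`. [folklore] -/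
def pricedSite (t : ℝ → ℝ → ℝ → ℝ) (R : ℝ) (x : Fin N → E3) (i : Fin N) : ℝ :=
  siteEnergy gS x i / 2 + cS + ∑ j ∈ Finset.univ.erase i, transfer t R x i j

/-- The multiset of ring VIEWS of the channel `(i, j)`: the pairs `(r_iw, r_jw)` over the ring. [folklore] -/
def ringView (R : ℝ) (x : Fin N → E3) (i j : Fin N) : Multiset (ℝ × ℝ) :=
  (ring R x i j).val.map (fun w => (dist (x i) (x w), dist (x j) (x w)))

/-- A site is SYMMETRIC at ring radius `R` when every one of its channels (shorter than `5/2`) has a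
swap-invariant multiset of ring views (both ends see the same bond in the same ring): every Bravais-lattice site
is symmetric (inversion through the bond midpoint exchanges the ends; fcc, bcc checked: 0 asymmetric channels at
`R = 2`), hcp interior sites are not (18 of 92 channels asymmetric at `R = 2`: the `√3·a` and `√(17/3)·a` ones),
nor are icosahedral / Tammes / Frank–Kasper Z14–Z16 centres or any site next to a defect. [folklore] -/
def SymmetricSite (R : ℝ) (x : Fin N → E3) (i : Fin N) : Prop :=
  ∀ j ∈ Finset.univ.erase i, ringView R x i j = (ringView R x i j).map Prod.swap

/-! ## Stubs -/

/-- STUB (worker/refuter-facing; the transfer-blind sites).  At ring radius `2`, every SYMMETRIC site of a finite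
configuration of distinct points has `s_i/2 + cS ≥ 0` (`cS = 657987/10⁶`).  No kernel can move anything into or
out of such a site (`transfer_eq_zero_of_symmetric`), so this floor is NECESSARY for every bond-view price
scheme; it contains the lattice floor `∀ Bravais L, −cS ≤ e_gS(L)` (fcc +0.006782 — the binding case —, bcc
+0.038: a 6-dimensional certified computation over reduced Gram cells); hcp sites are NOT symmetric under this
typing (kernel's side); the card's symmetric-environment oracle found nothing else dense (kit j022771/j023401).  Why it might fail: an exotic dense
environment, swap-symmetric along every channel without being locally a lattice, with site energy below
`−2cS = −1.315974`. [folklore] -/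
theorem stub_symmetricSiteFloor :
    ∀ (N : ℕ) (x : Fin N → E3), Function.Injective x → ∀ i : Fin N, SymmetricSite 2 x i →
      0 ≤ siteEnergy gS x i / 2 + cS := by
  sorry

/-- STUB (lead; the line's content = the bond-consistency LP of card bond-consistency-transfers, kernel form
v4).  There is ONE three-body kernel `t` such that on every finite configuration of distinct points every
NON-symmetric site has nonnegative priced value at ring radius `2`:
`0 ≤ s_i/2 + cS + Σ_{j≠i} (K_i(i,j) − K_j(j,i))`, `K_i(i,j) = Σ_{w ∈ ring₂(i,j)} t(r_ij, r_iw, r_jw)`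
(hcp interior sites are among them — base `+0.006728`, asymmetric only along the `√3·a`, `√(17/3)·a` channels).
Numerics (kit j023401, tree split, tensor-hat kernel of step 0.1, ≈ 3 042 hats): LP value `+0.00673` for every
transfer cap `Π ∈ {0.0003, …, 0.01}` through 20 rounds of column generation with breathing moves and exact
partner environments (pool 2 551 columns incl. the one-centre trap −0.387, compressed C15, the uniformly
over-bound R = 1.15 / 1.7 patches, capped icosahedra — all priced to ≥ +0.00673); NOT terminated (the oracle
still finds columns violating the current prices by 0.05–0.3), so no frozen kernel is certified: freezing `t`
and surviving a gradient adversary (lead a1's bench: insulated 18-hub, spectator, clean Z14 hub) is the first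
task; certification of a frozen rational `t` is Hales DSP §8.5-shaped (finite LP facts + low-dimensional cell
inequalities), Flyspeck-lite in size.  Why it might fail: a bond-CONSISTENT population of over-bound asymmetric
environments (negative LP value with zero elastic part) at ring radius 2. [folklore] -/
theorem stub_kernelDomination :
    ∃ t : ℝ → ℝ → ℝ → ℝ, ∀ (N : ℕ) (x : Fin N → E3), Function.Injective x → ∀ i : Fin N,
      ¬ SymmetricSite 2 x i → 0 ≤ pricedSite t 2 x i := by
  sorry

/-! ## Proved glue -/

/-- The ring is symmetric in the two ends of the channel. [folklore] -/
theorem ring_comm (R : ℝ) (x : Fin N → E3) (i j : Fin N) : ring R x i j = ring R x j i := by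
  simp only [ring, dist_comm (x j) (x i)]
  split_ifs
  · ext w
    simp only [Finset.mem_filter, Finset.mem_erase, Finset.mem_univ, and_true]
    tauto
  · rfl

/-- Transfers are antisymmetric in the channel ends, for EVERY kernel. [folklore] -/
theorem transfer_antisymm (t : ℝ → ℝ → ℝ → ℝ) (R : ℝ) (x : Fin N → E3) (i j : Fin N) :
    transfer t R x i j = -transfer t R x j i := by
  simp only [transfer]; ring

/-- The price read at the far end, re-indexed over the near end's ring: `K_j(j,i) = Σ_{w ∈ ring(i,j)} t(r_ij, r_jw, r_iw)`.
[folklore] -/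
theorem kernelPrice_swap (t : ℝ → ℝ → ℝ → ℝ) (R : ℝ) (x : Fin N → E3) (i j : Fin N) :
    kernelPrice t R x j i = ∑ w ∈ ring R x i j, t (dist (x i) (x j)) (dist (x j) (x w)) (dist (x i) (x w)) := by
  simp only [kernelPrice, ring_comm R x j i, dist_comm (x j) (x i)]

/-- **Symmetric channels carry nothing.** If the multiset of ring views of `(i, j)` is swap-invariant then the
transfer along `(i, j)` vanishes for every kernel: both ends read the same multiset. [folklore] -/
theorem transfer_eq_zero_of_symmetric_channel (t : ℝ → ℝ → ℝ → ℝ) (R : ℝ) (x : Fin N → E3) (i j : Fin N)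
    (h : ringView R x i j = (ringView R x i j).map Prod.swap) : transfer t R x i j = 0 := by
  have hK : kernelPrice t R x i j
      = ((ringView R x i j).map (fun p : ℝ × ℝ => t (dist (x i) (x j)) p.1 p.2)).sum := by
    simp only [kernelPrice, ringView, Multiset.map_map, Function.comp_def, Finset.sum_eq_multiset_sum]
  have hK' : kernelPrice t R x j i
      = (((ringView R x i j).map Prod.swap).map (fun p : ℝ × ℝ => t (dist (x i) (x j)) p.1 p.2)).sum := by
    simp only [kernelPrice_swap, ringView, Multiset.map_map, Function.comp_def, Prod.swap,
      Finset.sum_eq_multiset_sum]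
  rw [transfer, hK, hK', ← h, sub_self]

/-- **Symmetric sites receive nothing**, for every kernel. [folklore] -/
theorem transfer_sum_eq_zero_of_symmetric (t : ℝ → ℝ → ℝ → ℝ) (R : ℝ) (x : Fin N → E3) (i : Fin N)
    (h : SymmetricSite R x i) : ∑ j ∈ Finset.univ.erase i, transfer t R x i j = 0 :=
  Finset.sum_eq_zero fun j hj => transfer_eq_zero_of_symmetric_channel t R x i j (h j hj)

/-- Zero-sum: the total transfer over all sites vanishes (antisymmetry; the diagonal terms are `0`). [folklore] -/
theorem sum_transfer_eq_zero (t : ℝ → ℝ → ℝ → ℝ) (R : ℝ) (x : Fin N → E3) :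
    ∑ i, ∑ j ∈ Finset.univ.erase i, transfer t R x i j = 0 := by
  have hdiag : ∀ i : Fin N, transfer t R x i i = 0 := fun i => by simp only [transfer, sub_self]
  have hfull : ∀ i : Fin N, ∑ j ∈ Finset.univ.erase i, transfer t R x i j = ∑ j, transfer t R x i j := by
    intro i
    rw [← Finset.sum_erase_add _ _ (Finset.mem_univ i), hdiag, add_zero]
  simp_rw [hfull]
  have hanti : ∑ i, ∑ j, transfer t R x i j = -∑ i, ∑ j, transfer t R x i j :=
    calc ∑ i, ∑ j, transfer t R x i j = ∑ i, ∑ j, -transfer t R x j i :=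
          Finset.sum_congr rfl fun i _ => Finset.sum_congr rfl fun j _ => transfer_antisymm t R x i j
      _ = -∑ i, ∑ j, transfer t R x j i := by simp only [Finset.sum_neg_distrib]
      _ = -∑ i, ∑ j, transfer t R x i j := by rw [Finset.sum_comm]
  linarith

/-- **Hard-core-free reduction** (Lagarias's local-density theorem, one-centre form with zero-sum corrections):
if every priced site is nonnegative then `gS` is `cS`-stable on that configuration. [folklore] -/
theorem stable_of_pricedSites (t : ℝ → ℝ → ℝ → ℝ) (R : ℝ) {N : ℕ} (x : Fin N → E3)
    (h : ∀ i : Fin N, 0 ≤ pricedSite t R x i) : -(cS * (N : ℝ)) ≤ interactionEnergy gS x := by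
  have hsum : 0 ≤ ∑ i, pricedSite t R x i := Finset.sum_nonneg fun i _ => h i
  simp only [pricedSite, Finset.sum_add_distrib, sum_transfer_eq_zero, add_zero, Finset.sum_const,
    Finset.card_univ, Fintype.card_fin, nsmul_eq_mul] at hsum
  rw [← Finset.sum_div, ← two_mul_interactionEnergy] at hsum
  linarith

/-- **The local constant from the two stub STATEMENTS** (hypothesis form): a case split per site — symmetric
sites by the floor (their transfers vanish), the others by the kernel. [folklore] -/
theorem localConstant_of
    (h₁ : ∀ (N : ℕ) (x : Fin N → E3), Function.Injective x → ∀ i : Fin N, SymmetricSite 2 x i →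
      0 ≤ siteEnergy gS x i / 2 + cS)
    (h₂ : ∃ t : ℝ → ℝ → ℝ → ℝ, ∀ (N : ℕ) (x : Fin N → E3), Function.Injective x → ∀ i : Fin N,
      ¬ SymmetricSite 2 x i → 0 ≤ pricedSite t 2 x i) :
    ∀ (N : ℕ) (x : Fin N → E3), Function.Injective x → -(cS * (N : ℝ)) ≤ interactionEnergy gS x := by
  obtain ⟨t, ht⟩ := h₂
  intro N x hx
  refine stable_of_pricedSites t 2 x fun i => ?_
  by_cases hs : SymmetricSite 2 x i
  · have h0 := transfer_sum_eq_zero_of_symmetric t 2 x i hs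
    have hfloor := h₁ N x hx i hs
    simp only [pricedSite, h0, add_zero]
    exact hfloor
  · exact ht N x hx i hs

/-- **Composition, hypothesis form**: `stub₁-statement → stub₂-statement → OnePercentCertificate` (through the
landed reduction `OnePercentReduction.onePercentCertificate_of_local`, p112372). -/
theorem OnePercentCertificate_of_stubs
    (h₁ : ∀ (N : ℕ) (x : Fin N → E3), Function.Injective x → ∀ i : Fin N, SymmetricSite 2 x i →
      0 ≤ siteEnergy gS x i / 2 + cS)
    (h₂ : ∃ t : ℝ → ℝ → ℝ → ℝ, ∀ (N : ℕ) (x : Fin N → E3), Function.Injective x → ∀ i : Fin N,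
      ¬ SymmetricSite 2 x i → 0 ≤ pricedSite t 2 x i) :
    Summit.AtomisticToContinuum.Crystallization.Theses.ThreeConeCertificate.OnePercentCertificate :=
  OnePercentReduction.onePercentCertificate_of_local (localConstant_of h₁ h₂)

/-- **Composition.** The two stubs give the crux `OnePercentCertificate` BY NAME. -/
theorem OnePercentCertificate_of :
    Summit.AtomisticToContinuum.Crystallization.Theses.ThreeConeCertificate.OnePercentCertificate :=
  OnePercentCertificate_of_stubs stub_symmetricSiteFloor stub_kernelDomination

end Summit.AtomisticToContinuum.Crystallization.Cruxes.OnePercentCertificate.KernelTransfer
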